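import Summits.NavierStokesRegularity.NavierStokesRegularity.Theorems.FilamentSkeletonRssDefectColumnGateDefs

/-!
# Route `FilamentSkeletonRss` · crux `TransverseReduction1AR` (stmt-NavierStokesRegularity-23611, Variant A1R — rigid matched cores, clause 13-R) —
# line of record `defect_column_gate_1AR`: the line's VOCABULARY re-pointed at the R-crux, S0-FREE

Definitions (+ one `Iff.rfl` certificate), `--supports stmt-NavierStokesRegularity-23611 --as helper`; LEAD of 23611, lane ns-filament-21221-p1 g12 (DIRECTOR-NS dss_117 (4)
continuity + tenure g26's VET «(R-c) clock = the S0-FREE re-registration»; critic idea-crit-7 (R-e): «a DIRECT 1AR skeleton whose stubs take `Clauses1R` (with its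
rate conjunct) as a hypothesis and never quantify a rate row over all skeletons»).  THE ONE SWAP (route revs 53–54, the LEAD's LEAD-NOTES-23297-g12 §1.3): clause 13-J
→ clause 13-R (augmented in-ball form with the rate increment `dα`).  CONSEQUENCE FOR THE LINE: the v5 stub S0 `RateSelection1AL` (a rate row quantified over ALL
admissible skeletons — clause-shaped, LEAD R1) is DELETED: its content is now a HYPOTHESIS (conjunct 16 of `Clauses1R`) of every statement below, so S1 is
`DefectFamily1AR` outright and S2b-loc is `WaistColumnGateLoc1A → DefectGate1AR`.  Everything clause-free is REUSED from `…Defs.lean` / `…DefsL.lean` unchanged: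
`DefU1 … DefT1`, `Concl1`, `FamilySpec1AG`, `DefectGateSpec1AG`, `AlmostConcl1AG`, `DefectContinuity1AG` (S3b), the waist-column model and S2a-loc `WaistColumnGateLoc1A`.
Contents: `Clauses1R`; `CutForm1AR` + `transverseReduction1AR_iff : TransverseReduction1AR ↔ CutForm1AR := Iff.rfl`; stub statements `DefectFamily1AR` (S1),
`DefectGate1AR`, `GateAssemblyLoc1AR` (S2b-loc — FLAGGED MISSTATED by the LEAD's R4, kept verbatim-in-spec pending the (δ) MODEL word), `DefectClosing1AR` (S3),
`ClosingIVT1AR` (S3a).  All statements are `def … : Prop` and are NEVER asserted here.  HONEST FRAMING: bookkeeping for a HYPOTHETICAL filament-type rotating-self-similar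
blow-up route (MODEL rung, negative side); nothing here bears on Navier–Stokes regularity; `TransverseReduction1AR` is neither proved nor refuted.
-/

set_option linter.dupNamespace false

noncomputable section

namespace Summit.NavierStokesRegularity.NavierStokesRegularity.Theorems.DefectColumnGate

open scoped BigOperators Topology Manifold Classical MeasureTheory ProbabilityTheory Matrix InnerProductSpace ComplexConjugate ContinuousMap ENNReal ContDiff
open Filter Set Function TopologicalSpace MeasureTheory
open Literature.NS
open Literature.Analysis.FluidPDE
open Summit.NavierStokesRegularity.NavierStokesRegularity.Theses.FilamentSkeletonRss
open Summit.NavierStokesRegularity.NavierStokesRegularity.Theorems.KelvinGate (lerayOp lerayLin XBound YBound LocClose)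

/-! ## 1. The R-crux, cut at its arrows -/

/-- The `SkeletonJ1R` clause block of the crux's hypothesis: `Clauses1L` with clause 13-J replaced by clause 13-R (the AUGMENTED IN-BALL rate row:
phase-orthogonal ball-supported normal variations `Y` AND a rate increment `dα`, defect measured in the ball only, both controlled with the box
constant `cnd`); all other clauses VERBATIM (Variant A1R, route revs 53–54). -/
def Clauses1R (N : ℕ) (Γ δ ρ K Λ a b cnd Rw Rb cg θ₀ KA : ℝ) (γ : Fin N → ℝ) (α : ℝ) (X : Fin N → ℝ → EuclideanSpace ℝ (Fin 3)) (w : Fin N → ℝ → ℝ) (c : Fin N → ℝ) (m n : Fin N → EuclideanSpace ℝ (Fin 3)) (Aa : Fin N → ℝ → ℝ) (v : EuclideanSpace ℝ (Fin 3) → EuclideanSpace ℝ (Fin 3)) (A : Fin N → (EuclideanSpace ℝ (Fin 3) →L[ℝ] EuclideanSpace ℝ (Fin 3))) (T : (Fin N → ℝ → EuclideanSpace ℝ (Fin 3)) → Fin N → ℝ → EuclideanSpace ℝ (Fin 3)) : Prop :=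
  (α ≠ 0 ∧ (∀ j, γ j ≠ 0)∧(∀ j, ContDiff ℝ 2 (X j) ∧ Differentiable ℝ (w j)∧(∀ τ, ‖deriv (X j) τ‖ = 1)∧(∀ τ, ‖iteratedDeriv 2 (X j) τ‖*√Γ≤K) ∧ Tendsto (fun τ => ‖X j τ‖) (cocompact ℝ) atTop)∧(∀ j k, j ≠ k → ∀ τ σ, ρ*√Γ≤‖X j τ-X k σ‖)∧(∀ j τ σ, ρ*√Γ≤|τ-σ| → cg*ρ*√Γ≤‖X j τ-X j σ‖)∧(∀ j τ, cg*|τ-c j|≤Rw*√Γ+‖X j τ‖)∧(∀ j τ, w j τ = ⟪v (X j τ), deriv (X j) τ⟫_ℝ)∧(∀ j τ, ‖X j τ‖≤Rb*√(Γ*Real.log Γ) → v (X j τ) = w j τ•deriv (X j) τ)∧(∀ j, ‖X j (c j)‖≤Rw*√Γ)∧(∀ j, |⟪deriv (X j) (c j), EuclideanSpace.single 2 1⟫_ℝ|≤1-θ₀)∧(θ₀≤|α| ∧ |α|≤θ₀⁻¹ ∧ ∀ j, θ₀≤|γ j| ∧ |γ j|≤θ₀⁻¹)∧(∀ j, w j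 (c j) = 0 ∧ (∀ τ, w j τ = 0 → τ = c j) ∧ 3/2+δ≤deriv (w j) (c j) ∧ deriv (w j) (c j)≤Λ)∧(∀ j, Differentiable ℝ (Aa j) ∧ (∀ τ, 0 < Aa j τ) ∧ 1≤KA*Aa j (c j) ∧ ∀ τ, ‖X j τ‖≤2*Rb*√(Γ*Real.log Γ) → Aa j τ = Aa j (c j))∧(∀ j τ, Rw^2*Γ*Aa j τ≤KA*(Rw^2*Γ+‖X j τ‖^2))∧(∀ j, Orthonormal ℝ ![deriv (X j) (c j), m j, n j] ∧ ⟪A j (m j), m j⟫_ℝ+⟪A j (n j), n j⟫_ℝ < 0 ∧ ⟪A j (n j), m j⟫_ℝ * ⟪A j (m j), n j⟫_ℝ < ⟪A j (m j), m j⟫_ℝ * ⟪A j (n j), n j⟫_ℝ)∧(∀ Y:Fin N → ℝ → EuclideanSpace ℝ (Fin 3), (∀ j, ContDiff ℝ 2 (Y j))→(∀ j τ, ⟪Y j τ, deriv (X j) τ⟫_ℝ = 0) → (∀ j τ, Rb*√(Γ*Real.log Γ) < ‖X j τ‖ → Y j τ = 0) → ∑ j, ⟪Y j (c j), cross (EuclideanSpace.single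 2 1) (X j (c j))⟫_ℝ = 0 → (∀ j τ, ‖Y j τ‖+‖deriv (Y j) τ‖+‖iteratedDeriv 2 (Y j) τ‖≤(1+|τ-c j|)^b) → ∀ dα L:ℝ, (∀ j τ, ‖X j τ‖≤Rb*√(Γ*Real.log Γ) → ‖deriv (fun s:ℝ => T (fun k σ => X k σ+s•Y k σ) j τ) 0-dα•(cross (EuclideanSpace.single 2 1) (X j τ)-⟪cross (EuclideanSpace.single 2 1) (X j τ), deriv (X j) τ⟫_ℝ•deriv (X j) τ)‖≤L*(1+|τ-c j|)^a) → (∀ j τ, ‖Y j τ‖≤cnd*L*(1+|τ-c j|)^b) ∧ |dα| * √Γ≤cnd*L))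

/-- The CUT FORM of the crux: hypotheses `DefU1 … Clauses1R`, conclusion `Concl1` (an `abbrev`, so that the line's glue theorem
concludes THIS constant and only `TransverseReduction1AR_of` below concludes the crux by name — skeleton A12 shape). -/
abbrev CutForm1AR : Prop :=
    ∀ (N : ℕ) (δ ρ K Λ a b cnd η Rw Rb cg θ₀ KA : ℝ), 0 < N → 0 < δ → 0 < ρ → 0 ≤ a → 0 < η → 0 < Rw → 0 < Rb → 0 < cg → 0 < θ₀ → ∃ Γ₁ : ℝ, ∀ Γ : ℝ, Γ₁ ≤ Γ → ∀ (γ : Fin N → ℝ) (α : ℝ) (X : Fin N → ℝ → EuclideanSpace ℝ (Fin 3)) (w : Fin N → ℝ → ℝ) (c : Fin N → ℝ) (m n : Fin N → EuclideanSpace ℝ (Fin 3)) (Aa : Fin N → ℝ → ℝ) (u : (Fin N → ℝ → EuclideanSpace ℝ (Fin 3)) → EuclideanSpace ℝ (Fin 3) → EuclideanSpace ℝ (Fin 3)) (v : EuclideanSpace ℝ (Fin 3) → EuclideanSpace ℝ (Fin 3)) (A : Fin N → (EuclideanSpace ℝ (Fin 3) →L[ℝ] EuclideanSpace ℝ (Fin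 3))) (T : (Fin N → ℝ → EuclideanSpace ℝ (Fin 3)) → Fin N → ℝ → EuclideanSpace ℝ (Fin 3)),
      DefU1 N Γ γ Aa u → DefV1 N α X u v → DefA1 N X c v A → DefT1 N α u T → Clauses1R N Γ δ ρ K Λ a b cnd Rw Rb cg θ₀ KA γ α X w c m n Aa v A T → ∃ (α₁ C₀ M : ℝ) (U : EuclideanSpace ℝ (Fin 3) → EuclideanSpace ℝ (Fin 3)) (P : EuclideanSpace ℝ (Fin 3) → ℝ), Concl1 N Γ ρ η Rw X u α₁ C₀ M U P

/-- CERTIFICATE that §1 is the crux: the route decl `TransverseReduction1AR` (item 23611) unfolds to the cut form by `Iff.rfl`. -/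
theorem transverseReduction1AR_iff : TransverseReduction1AR ↔ CutForm1AR :=
  Iff.rfl

/-! ## 2. The statements of the line, re-pointed at the R-crux (S0 DELETED: the rate row is clause 13-R of `Clauses1R`, READ from the hypothesis block by S1 and S2b-loc; S2a-loc `WaistColumnGateLoc1A` and S3b `DefectContinuity1AG` are clause-free and reused) -/

/-- **Statement of stub S1 · `DefectFamily1AR`** (size XL; the former `FamilyDressing` with its `RateSelection` antecedent deleted — the rate row is clause 13-R of the hypothesis block) — existence of the re-wound defect family (spec `FamilySpec1AG`) for EVERY requested window exponent
`q₁` and order `k`, with size constant `Cs` uniform in both; residual constant `Cr` and threshold `Γ₁` may depend on `q₁, k`. -/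
def DefectFamily1AR : Prop :=
  ∀ (N : ℕ) (δ ρ K Λ a b cnd η Rw Rb cg θ₀ KA : ℝ), 0 < N → 0 < δ → 0 < ρ → 0 ≤ a → 0 < η → 0 < Rw → 0 < Rb → 0 < cg → 0 < θ₀ →
    ∃ Cs : ℝ, ∀ (q₁ : ℝ) (k : ℕ), ∃ Cr Γ₁ : ℝ, ∀ Γ : ℝ, Γ₁ ≤ Γ → ∀ (γ : Fin N → ℝ) (α : ℝ) (X : Fin N → ℝ → EuclideanSpace ℝ (Fin 3)) (w : Fin N → ℝ → ℝ) (c : Fin N → ℝ) (m n : Fin N → EuclideanSpace ℝ (Fin 3)) (Aa : Fin N → ℝ → ℝ) (u : (Fin N → ℝ → EuclideanSpace ℝ (Fin 3)) → EuclideanSpace ℝ (Fin 3) → EuclideanSpace ℝ (Fin 3)) (v : EuclideanSpace ℝ (Fin 3) → EuclideanSpace ℝ (Fin 3)) (A : Fin N → (EuclideanSpace ℝ (Fin 3) →L[ℝ] EuclideanSpace ℝ (Fin 3))) (T : (Fin N → ℝ → EuclideanSpace ℝ (Fin 3)) → Fin N → ℝ → EuclideanSpace ℝ (Fin 3)),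
      DefU1 N Γ γ Aa u → DefV1 N α X u v → DefA1 N X c v A → DefT1 N α u T → Clauses1R N Γ δ ρ K Λ a b cnd Rw Rb cg θ₀ KA γ α X w c m n Aa v A T →
      ∃ (α0 β₀ : ℝ) (U0 : ℝ → EuclideanSpace ℝ (Fin 3) → EuclideanSpace ℝ (Fin 3)) (P0 : ℝ → EuclideanSpace ℝ (Fin 3) → ℝ) (Z : ℝ → EuclideanSpace ℝ (Fin 3) → EuclideanSpace ℝ (Fin 3)) (g : ℝ → ℝ) (r : ℝ → EuclideanSpace ℝ (Fin 3) → EuclideanSpace ℝ (Fin 3)),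
        FamilySpec1AG N Γ ρ η Rw Rb θ₀ k Cs Cr q₁ α X u α0 β₀ U0 P0 Z g r

/-- **Conclusion of stub S2b** — around EVERY re-wound defect family with sufficiently narrow window `q₁ ≥ q₀` and sufficiently
high order `k ≥ k₀` (size `Cs`) there is a defect-bordered frozen-rate gate (spec `DefectGateSpec1AG`) with exponent `κ` and
constant `C₂` depending on the box constants and `Cs` only — not on `Γ`, the skeleton, the family, `q₁` or `k`. -/
def DefectGate1AR : Prop :=
  ∀ (N : ℕ) (δ ρ K Λ a b cnd η Rw Rb cg θ₀ KA : ℝ), 0 < N → 0 < δ → 0 < ρ → 0 ≤ a → 0 < η → 0 < Rw → 0 < Rb → 0 < cg → 0 < θ₀ →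
    ∀ Cs : ℝ, ∃ κ C₂ q₀ : ℝ, ∃ k₀ : ℕ, ∀ q₁ : ℝ, q₀ ≤ q₁ → ∀ k : ℕ, k₀ ≤ k → 1 ≤ k → ∀ Cr : ℝ, ∃ Γ₁ : ℝ, ∀ Γ : ℝ, Γ₁ ≤ Γ → ∀ (γ : Fin N → ℝ) (α : ℝ) (X : Fin N → ℝ → EuclideanSpace ℝ (Fin 3)) (w : Fin N → ℝ → ℝ) (c : Fin N → ℝ) (m n : Fin N → EuclideanSpace ℝ (Fin 3)) (Aa : Fin N → ℝ → ℝ) (u : (Fin N → ℝ → EuclideanSpace ℝ (Fin 3)) → EuclideanSpace ℝ (Fin 3) → EuclideanSpace ℝ (Fin 3)) (v : EuclideanSpace ℝ (Fin 3) → EuclideanSpace ℝ (Fin 3)) (A : Fin N → (EuclideanSpace ℝ (Fin 3) →L[ℝ] EuclideanSpace ℝ (Fin 3))) (T : (Fin N → ℝ → EuclideanSpace ℝ (Fin 3)) → Fin N → ℝ → EuclideanSpace ℝ (Fin 3)),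
      DefU1 N Γ γ Aa u → DefV1 N α X u v → DefA1 N X c v A → DefT1 N α u T → Clauses1R N Γ δ ρ K Λ a b cnd Rw Rb cg θ₀ KA γ α X w c m n Aa v A T →
      ∀ (α0 β₀ : ℝ) (U0 : ℝ → EuclideanSpace ℝ (Fin 3) → EuclideanSpace ℝ (Fin 3)) (P0 : ℝ → EuclideanSpace ℝ (Fin 3) → ℝ) (Z : ℝ → EuclideanSpace ℝ (Fin 3) → EuclideanSpace ℝ (Fin 3)) (g : ℝ → ℝ) (r : ℝ → EuclideanSpace ℝ (Fin 3) → EuclideanSpace ℝ (Fin 3)),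
        FamilySpec1AG N Γ ρ η Rw Rb θ₀ k Cs Cr q₁ α X u α0 β₀ U0 P0 Z g r →
      ∃ (𝓚 : ℝ → (EuclideanSpace ℝ (Fin 3) → EuclideanSpace ℝ (Fin 3)) → EuclideanSpace ℝ (Fin 3) → EuclideanSpace ℝ (Fin 3)) (𝓠 : ℝ → (EuclideanSpace ℝ (Fin 3) → EuclideanSpace ℝ (Fin 3)) → EuclideanSpace ℝ (Fin 3) → ℝ) (𝓫 : ℝ → (EuclideanSpace ℝ (Fin 3) → EuclideanSpace ℝ (Fin 3)) → ℝ),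
        DefectGateSpec1AG Γ κ C₂ β₀ α0 U0 Z 𝓚 𝓠 𝓫

/-- **Statement of stub S3 · `DefectClosing1AR` (size L; frozen-rate contraction at each `β` + CONTINUITY in `β` + the
intermediate-value theorem on the scalar defect).**  Given the size `Cs`, the gate's `κ, C₂` and ANY thresholds `q₀, k₀`, SOME
window exponent `q₁ ≥ q₀` and order `k ≥ k₀` (`k > κ + q₁ + 6`) suffice: for every family of that order and every defect gate around it, for `Γ ≥ Γ₁`, at each `|β| ≤ β₀` the map
`G ↦ −r_β − D(𝓚_β G)[𝓚_β G]` has a fixed point `G_β` in a Y-ball of radius `2Cr Γ^(−k)`, `β ↦ b_β := 𝓫_β G_β` is continuous with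
`|b_β| < Γ^(−q₁)`, so `g(β*) + b_(β*) = 0` for some `β*` in the window; then `α₁ = α⁰ + β* ≠ 0`, `U = U⁰_(β*) + 𝓚 G`, `P = P⁰ + 𝓠 G`
satisfy the crux's conclusion with `C²/C¹` regularity (`U ≠ 0` from the non-degeneracy point `y₀`). -/
def DefectClosing1AR : Prop :=
  ∀ (N : ℕ) (δ ρ K Λ a b cnd η Rw Rb cg θ₀ KA : ℝ), 0 < N → 0 < δ → 0 < ρ → 0 ≤ a → 0 < η → 0 < Rw → 0 < Rb → 0 < cg → 0 < θ₀ →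
    ∀ Cs κ C₂ q₀ : ℝ, ∀ k₀ : ℕ, ∃ q₁ : ℝ, q₀ ≤ q₁ ∧ ∃ k : ℕ, k₀ ≤ k ∧ 1 ≤ k ∧ ∀ Cr : ℝ, ∃ Γ₁ : ℝ, ∀ Γ : ℝ, Γ₁ ≤ Γ → ∀ (γ : Fin N → ℝ) (α : ℝ) (X : Fin N → ℝ → EuclideanSpace ℝ (Fin 3)) (w : Fin N → ℝ → ℝ) (c : Fin N → ℝ) (m n : Fin N → EuclideanSpace ℝ (Fin 3)) (Aa : Fin N → ℝ → ℝ) (u : (Fin N → ℝ → EuclideanSpace ℝ (Fin 3)) → EuclideanSpace ℝ (Fin 3) → EuclideanSpace ℝ (Fin 3)) (v : EuclideanSpace ℝ (Fin 3) → EuclideanSpace ℝ (Fin 3)) (A : Fin N → (EuclideanSpace ℝ (Fin 3) →L[ℝ] EuclideanSpace ℝ (Fin 3))) (T : (Fin N → ℝ → EuclideanSpace ℝ (Fin 3)) → Fin N → ℝ → EuclideanSpace ℝ (Fin 3)),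
      DefU1 N Γ γ Aa u → DefV1 N α X u v → DefA1 N X c v A → DefT1 N α u T → Clauses1R N Γ δ ρ K Λ a b cnd Rw Rb cg θ₀ KA γ α X w c m n Aa v A T →
      ∀ (α0 β₀ : ℝ) (U0 : ℝ → EuclideanSpace ℝ (Fin 3) → EuclideanSpace ℝ (Fin 3)) (P0 : ℝ → EuclideanSpace ℝ (Fin 3) → ℝ) (Z : ℝ → EuclideanSpace ℝ (Fin 3) → EuclideanSpace ℝ (Fin 3)) (g : ℝ → ℝ) (r : ℝ → EuclideanSpace ℝ (Fin 3) → EuclideanSpace ℝ (Fin 3)),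
        FamilySpec1AG N Γ ρ η Rw Rb θ₀ k Cs Cr q₁ α X u α0 β₀ U0 P0 Z g r →
      ∀ (𝓚 : ℝ → (EuclideanSpace ℝ (Fin 3) → EuclideanSpace ℝ (Fin 3)) → EuclideanSpace ℝ (Fin 3) → EuclideanSpace ℝ (Fin 3)) (𝓠 : ℝ → (EuclideanSpace ℝ (Fin 3) → EuclideanSpace ℝ (Fin 3)) → EuclideanSpace ℝ (Fin 3) → ℝ) (𝓫 : ℝ → (EuclideanSpace ℝ (Fin 3) → EuclideanSpace ℝ (Fin 3)) → ℝ),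
        DefectGateSpec1AG Γ κ C₂ β₀ α0 U0 Z 𝓚 𝓠 𝓫 →
      ∃ (α₁ C₀ M : ℝ) (U : EuclideanSpace ℝ (Fin 3) → EuclideanSpace ℝ (Fin 3)) (P : EuclideanSpace ℝ (Fin 3) → ℝ), AlmostConcl1AG N Γ ρ η Rw X u α₁ C₀ M U P


/-- **Statement of stub S3a · `ClosingIVT1AR`**: `DefectContinuity1AG → DefectClosing1AR` (the analytic half of S3; S3b `DefectContinuity1AG` is
clause-free and already proved, p646054; S3a is ported in `…ClosingIVTR.lean`). -/
def ClosingIVT1AR : Prop :=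
  DefectContinuity1AG → DefectClosing1AR

/-- **Statement of stub S2b-loc · `GateAssemblyLoc1AR`**: patching the LOCALISED sectional gate (S2a-loc, clause-free, unchanged) into the defect-bordered gate;
the rate row is READ from clause 13-R of the hypothesis block of `DefectGate1AR` (no `RateSelection` antecedent).  FLAGGED MISSTATED by the LEAD's R4 (waist-accretion
cokernel, memo `Lines/defect_column_gate_1AL_accretion.md`): the consequent's gate spec `DefectGateSpec1AG` is the v5 one, kept VERBATIM here pending the (δ) MODEL word
(dss_117); a two-scale re-cut (γ) would replace it. -/
def GateAssemblyLoc1AR : Prop :=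
  WaistColumnGateLoc1A → DefectGate1AR

end Summit.NavierStokesRegularity.NavierStokesRegularity.Theorems.DefectColumnGate

end
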